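import Mathlib
import HarnessLib
import Summits.NavierStokesRegularity.NavierStokesRegularity.Theorems.PoloidalWindowDoorLrcModEntireCurvedSheetTransport
import Summits.NavierStokesRegularity.NavierStokesRegularity.Theorems.PoloidalWindowDoorLrcModEntireGraphTransportRigidity

/-!
# Route `PoloidalWindowDoor`, item `LrcModEntire` (stmt-NavierStokesRegularity-20428), cell (Q4-sonic, straight, μ < 0) `stub_Q4sonicLineNeg`, case I —
# BRICK B-T (PDE half): THE GRAPH TRANSPORT LAW ON AN `s`-MODULATED SONIC WEB SHEET

Cell ns-regularity-ideate, stub-worker seat ns-poloidal-K2-p2 g16 under the LEAD of item 20428 (ns-poloidal-K2-p3 g17);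
`--supports stmt-NavierStokesRegularity-20428 --as helper`.  Memo `Cruxes/LrcModEntire/T2B-g17.md` v2 §1 (case I) / §5(5g) BRICK B-T.  The `s`-DEPENDENT generalisation
of LEAD's `…SheetTransport` (straight branch, `s`-free offset) and of this seat's `…CurvedSheetTransport` (curved branch, `s`-free offset), in GRAPH COORDINATES over
the line: the sheet is `W(s,z) = s·e + G(s,z)·Je + z·e₂` (`webMap e G`) with `G` a priori depending on `s`.

Setting (class-free, one fixed time): `θ ∈ C³` solves the slice law `D²θ[e₂,e₂] = −μ(x₂)(D²θ[e,e] + D²θ[Je,Je])` on the slab `{x₂ ∈ I}`; on the region `ℝ × I`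
the sheet carries WEB CRITICALITY `∂_eθ(W) = ∂_{Je}θ(W) = 0`, a CONSTANT VERTICAL GRADIENT `∂₂θ(W) = β` (⟸ values `R(z)` affine: the SONIC literal), the RIDGE LAW
`D²θ(W)[e,e] + D²θ(W)[Je,Je] = −K(z)` (`s`-free) and non-degeneracy `A := D²θ(W)[Je,Je] ≠ 0`; `μ < 0` on `I`, `μ, K` differentiable there.  Then at every sheet point:

* `hessian_on_sonic_sheet` — the web Hessian is RANK ONE along the conormal `n = Je − G_s e − G_z e₂`:
  `D²θ(W)[e,Je] = −G_sA`, `D²θ(W)[e₂,Je] = −G_zA`, `D²θ(W)[e,e] = G_s²A`, `D²θ(W)[e₂,e₂] = G_z²A`, and the sheet is NULL (eikonal relation)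
  (E) `G_z² = −μ(z)(1 + G_s²)`;
* ★ `eikonal_transport_on_sonic_sheet` — (E) together with the TRANSPORT RELATION
  (T) `μ²K²·G_ss = −(1 + G_s²)·G_z·(½μ′K² + 2μKK′)`,
  obtained from the GRAPH TRANSPORT LAW `G_zz A + 2G_z A_z + μ(G_ss A + 2G_s A_s) = 0` (`∂_{Je}` of the slice law at `W`; the transversal third derivative
  `D³θ[Je,Je,Je]` drops out exactly by (E) — `…GraphTransportRigidity.star_algebra`) and the tangential derivatives of the ridge law and of (E)
  (`…GraphTransportRigidity.transport_algebra`; the two polynomial identities were machine-derived and checked before typing).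

* ★★ `sfree_of_sonic_sheet` — with `…GraphTransportRigidity.sfree_eikonal` ((E)+(T)+`μ<0`+`|G| ≤ r` ⇒ `G_s ≡ 0`): **B-T (i) the webs at a sonic time are
  `e`-PARALLEL LINES `G(s,z) = d(z)`, and (ii) `d′(z)² = −μ(z)`** — class-free, pin-free, hot-free; the binder-level instantiation at time `−1+τ` is bookkeeping
  over `…Q4WebPackage` (web function at time `τ`, `webData_of_fderiv_uncurry`, `laplacian`/ridge law at web points, `plane_wave_identity`).  WHAT THIS IS NOT: not a claim about Navier–Stokes regularity — class-free calculus for research cell (Q4-sonic) of line twist_split; items 20428 /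
19708 / 27893 OPEN.
-/

noncomputable section

-- the summit and its single sub-problem share the name (CONVENTIONS §1), as in every Theorems file
set_option linter.dupNamespace false

namespace Summit.NavierStokesRegularity.NavierStokesRegularity.Theorems.PoloidalWindowDoorLrcModEntireGraphTransport

open Set Function Filter Topology
open scoped InnerProductSpace RealInnerProductSpace ContDiff
open Summit.NavierStokesRegularity.NavierStokesRegularity.Theorems.PoloidalWindowDoorLrcModEntireSheetFlattenTools
open Summit.NavierStokesRegularity.NavierStokesRegularity.Theorems.PoloidalWindowDoorLrcModEntireParallelWebsIdentity
open Summit.NavierStokesRegularity.NavierStokesRegularity.Theorems.PoloidalWindowDoorLrcModEntireCurvedSheetTransport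
open Summit.NavierStokesRegularity.NavierStokesRegularity.Theorems.PoloidalWindowDoorLrcModEntireGraphTransportRigidity

/-! ### B. Calculus on the graph sheet -/

section calculus

variable {θ : EuclideanSpace ℝ (Fin 3) → ℝ} {e : EuclideanSpace ℝ (Fin 3)} {G : ℝ × ℝ → ℝ} {p : ℝ × ℝ}

/-- Tangential derivative of a gradient component along the sheet: `D(q ↦ ∂_vθ(W q))[h] = D²θ(W)[DW h, v]`. -/
theorem fderiv_grad_comp (hθ : ContDiff ℝ 2 θ) (hG : DifferentiableAt ℝ G p) (v : EuclideanSpace ℝ (Fin 3)) (h : ℝ × ℝ) :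
    fderiv ℝ (fun q => fderiv ℝ θ (webMap e G q) v) p h =
      fderiv ℝ (fderiv ℝ θ) (webMap e G p) (h.1 • e + fderiv ℝ G p h • Jvec e + h.2 • e2) v := by
  have hg : DifferentiableAt ℝ (fun y => fderiv ℝ θ y v) (webMap e G p) :=
    (((hθ.fderiv_right (m := 1) (by norm_cast)).differentiable (by norm_cast)) _).clm_apply (differentiableAt_const v)
  rw [fderiv_comp_webMap e hG hg h, nested_eq_fderiv_fderiv hθ]

/-- Tangential derivative of a Hessian entry along the sheet: `D(q ↦ D²θ(W q)[u,v])[h] = D³θ(W)[DW h, u, v]`. -/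
theorem fderiv_hess_comp (hθ : ContDiff ℝ 3 θ) (hG : DifferentiableAt ℝ G p) (u v : EuclideanSpace ℝ (Fin 3)) (h : ℝ × ℝ) :
    fderiv ℝ (fun q => fderiv ℝ (fderiv ℝ θ) (webMap e G q) u v) p h =
      fderiv ℝ (fderiv ℝ (fderiv ℝ θ)) (webMap e G p) (h.1 • e + fderiv ℝ G p h • Jvec e + h.2 • e2) u v := by
  have hD2c : ContDiff ℝ 1 (fderiv ℝ (fderiv ℝ θ)) := (hθ.fderiv_right (m := 2) (by norm_cast)).fderiv_right (m := 1) (by norm_cast)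
  have hD2 := hD2c.differentiable one_ne_zero
  have hg : DifferentiableAt ℝ (fun y => fderiv ℝ (fderiv ℝ θ) y u v) (webMap e G p) :=
    ((hD2 _).clm_apply (differentiableAt_const u)).clm_apply (differentiableAt_const v)
  rw [fderiv_comp_webMap e hG hg h, fderiv_hessian_apply_const hθ]

/-- Differentiability of `q ↦ D²θ(W q)[u,v]` at a point where `G` is differentiable. -/
theorem differentiableAt_hess_comp (hθ : ContDiff ℝ 3 θ) (hG : DifferentiableAt ℝ G p) (u v : EuclideanSpace ℝ (Fin 3)) :
    DifferentiableAt ℝ (fun q => fderiv ℝ (fderiv ℝ θ) (webMap e G q) u v) p := by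
  have hD2c : ContDiff ℝ 1 (fderiv ℝ (fderiv ℝ θ)) := (hθ.fderiv_right (m := 2) (by norm_cast)).fderiv_right (m := 1) (by norm_cast)
  have hD2 := hD2c.differentiable one_ne_zero
  have hc : DifferentiableAt ℝ (fun q => fderiv ℝ (fderiv ℝ θ) (webMap e G q)) p := (hD2 _).comp p (hasFDerivAt_webMap e hG).differentiableAt
  exact (hc.clm_apply (differentiableAt_const u)).clm_apply (differentiableAt_const v)

/-- Derivative of a Hessian entry along a straight line: `d/dt D²θ(x + t w)[u,v] |ₜ₌₀ = D³θ(x)[w,u,v]`. -/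
theorem hasDerivAt_hess_line (hθ : ContDiff ℝ 3 θ) (x w u v : EuclideanSpace ℝ (Fin 3)) :
    HasDerivAt (fun t : ℝ => fderiv ℝ (fderiv ℝ θ) (x + t • w) u v) (fderiv ℝ (fderiv ℝ (fderiv ℝ θ)) x w u v) 0 := by
  have hD2c : ContDiff ℝ 1 (fderiv ℝ (fderiv ℝ θ)) := (hθ.fderiv_right (m := 2) (by norm_cast)).fderiv_right (m := 1) (by norm_cast)
  have hD2 := hD2c.differentiable one_ne_zero
  have hg : DifferentiableAt ℝ (fun y => fderiv ℝ (fderiv ℝ θ) y u v) (x + (0 : ℝ) • w) :=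
    ((hD2 _).clm_apply (differentiableAt_const u)).clm_apply (differentiableAt_const v)
  have hline : HasDerivAt (fun t : ℝ => x + t • w) w 0 := by
    simpa using ((hasDerivAt_id (0 : ℝ)).smul_const w).const_add x
  have hc := hg.hasFDerivAt.comp_hasDerivAt (0 : ℝ) hline
  simp only [zero_smul, add_zero] at hc
  rw [fderiv_hessian_apply_const hθ] at hc
  exact hc

end calculus

/-! ### C. The Hessian and the eikonal relation on a sonic sheet -/

section sheet

variable {θ : EuclideanSpace ℝ (Fin 3) → ℝ} {e : EuclideanSpace ℝ (Fin 3)} {I : Set ℝ} {μ μ' K K' : ℝ → ℝ} {G : ℝ × ℝ → ℝ} {β : ℝ}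

/-- The third coordinate of a graph-sheet point is the height. -/
theorem webMap_apply_two (he2 : e 2 = 0) (G : ℝ × ℝ → ℝ) (p : ℝ × ℝ) : webMap e G p 2 = p.2 := by
  simp [webMap, Jvec, e2, he2]

/-- **The web Hessian on a sonic sheet is rank one along the conormal, and the sheet is null.**  See the module docstring. -/
theorem hessian_on_sonic_sheet (hθ : ContDiff ℝ 3 θ) (he2 : e 2 = 0) (hI : IsOpen I) (hG : ContDiffOn ℝ 2 G (region I))
    (hlaw : ∀ x : EuclideanSpace ℝ (Fin 3), x 2 ∈ I →
      fderiv ℝ (fderiv ℝ θ) x e2 e2 = -μ (x 2) * (fderiv ℝ (fderiv ℝ θ) x e e + fderiv ℝ (fderiv ℝ θ) x (Jvec e) (Jvec e)))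
    (hce : ∀ p ∈ region I, fderiv ℝ θ (webMap e G p) e = 0)
    (hcJ : ∀ p ∈ region I, fderiv ℝ θ (webMap e G p) (Jvec e) = 0)
    (hc2 : ∀ p ∈ region I, fderiv ℝ θ (webMap e G p) e2 = β)
    (hA : ∀ p ∈ region I, fderiv ℝ (fderiv ℝ θ) (webMap e G p) (Jvec e) (Jvec e) ≠ 0) :
    ∀ p ∈ region I,
      fderiv ℝ (fderiv ℝ θ) (webMap e G p) e (Jvec e) = -fderiv ℝ G p (1, 0) * fderiv ℝ (fderiv ℝ θ) (webMap e G p) (Jvec e) (Jvec e) ∧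
      fderiv ℝ (fderiv ℝ θ) (webMap e G p) e2 (Jvec e) = -fderiv ℝ G p (0, 1) * fderiv ℝ (fderiv ℝ θ) (webMap e G p) (Jvec e) (Jvec e) ∧
      fderiv ℝ (fderiv ℝ θ) (webMap e G p) e e = fderiv ℝ G p (1, 0) ^ 2 * fderiv ℝ (fderiv ℝ θ) (webMap e G p) (Jvec e) (Jvec e) ∧
      fderiv ℝ (fderiv ℝ θ) (webMap e G p) e2 e2 = fderiv ℝ G p (0, 1) ^ 2 * fderiv ℝ (fderiv ℝ θ) (webMap e G p) (Jvec e) (Jvec e) ∧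
      fderiv ℝ G p (0, 1) ^ 2 = -μ p.2 * (1 + fderiv ℝ G p (1, 0) ^ 2) := by
  intro p hp
  have hθ2 : ContDiff ℝ 2 θ := hθ.of_le (by norm_cast)
  have hGd : DifferentiableAt ℝ G p := (hG.contDiffAt ((isOpen_region hI).mem_nhds hp)).differentiableAt (by norm_num)
  have hsym : ∀ u v, fderiv ℝ (fderiv ℝ θ) (webMap e G p) u v = fderiv ℝ (fderiv ℝ θ) (webMap e G p) v u := fun u v =>
    (hθ2.contDiffAt.isSymmSndFDerivAt (by simp)) u v
  set x := webMap e G p with hx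
  set H := fderiv ℝ (fderiv ℝ θ) x with hH
  set Ps := fderiv ℝ G p (1, 0) with hPs
  set Pz := fderiv ℝ G p (0, 1) with hPz
  -- derivatives of the three (constant) gradient components along the two sheet directions
  have hdJ : ∀ h : ℝ × ℝ, H (h.1 • e + fderiv ℝ G p h • Jvec e + h.2 • e2) (Jvec e) = 0 := fun h => by
    rw [hH, hx, ← fderiv_grad_comp hθ2 hGd]; exact fderiv_eq_zero_of_eqOn_region hI hcJ hp h
  have hde : ∀ h : ℝ × ℝ, H (h.1 • e + fderiv ℝ G p h • Jvec e + h.2 • e2) e = 0 := fun h => by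
    rw [hH, hx, ← fderiv_grad_comp hθ2 hGd]; exact fderiv_eq_zero_of_eqOn_region hI hce hp h
  have hd2 : ∀ h : ℝ × ℝ, H (h.1 • e + fderiv ℝ G p h • Jvec e + h.2 • e2) e2 = 0 := fun h => by
    rw [hH, hx, ← fderiv_grad_comp hθ2 hGd]
    have h0 : ∀ q ∈ region I, (fun q => fderiv ℝ θ (webMap e G q) e2 - β) q = 0 := fun q hq => by simp [hc2 q hq]
    have h1 := fderiv_eq_zero_of_eqOn_region hI h0 hp h
    rwa [fderiv_sub_const] at h1
  have c1 : H e (Jvec e) = -Ps * H (Jvec e) (Jvec e) := by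
    have h := hdJ (1, 0)
    simp only [one_smul, zero_smul, add_zero, map_add, map_smul, _root_.add_apply, _root_.smul_apply,
      smul_eq_mul] at h
    linear_combination h
  have c2 : H e2 (Jvec e) = -Pz * H (Jvec e) (Jvec e) := by
    have h := hdJ (0, 1)
    simp only [one_smul, zero_smul, zero_add, map_add, map_smul, _root_.add_apply, _root_.smul_apply,
      smul_eq_mul] at h
    linear_combination h
  have c3 : H e e = Ps ^ 2 * H (Jvec e) (Jvec e) := by
    have h := hde (1, 0)
    simp only [one_smul, zero_smul, add_zero, map_add, map_smul, _root_.add_apply, _root_.smul_apply,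
      smul_eq_mul] at h
    rw [hsym (Jvec e) e, c1] at h
    linear_combination h
  have c5 : H e2 e2 = Pz ^ 2 * H (Jvec e) (Jvec e) := by
    have h := hd2 (0, 1)
    simp only [one_smul, zero_smul, zero_add, map_add, map_smul, _root_.add_apply, _root_.smul_apply,
      smul_eq_mul] at h
    rw [hsym (Jvec e) e2, c2] at h
    linear_combination h
  have hx2 : x 2 = p.2 := webMap_apply_two he2 G p
  have hl := hlaw x (by rw [hx2]; exact hp)
  rw [hx2] at hl
  refine ⟨c1, c2, c3, c5, ?_⟩
  have hE0 : H (Jvec e) (Jvec e) * (Pz ^ 2 + μ p.2 * (1 + Ps ^ 2)) = 0 := by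
    rw [← hH] at hl; rw [c5, c3] at hl; linear_combination hl
  rcases mul_eq_zero.1 hE0 with h | h
  · exact absurd h (hA p hp)
  · linear_combination h

end sheet

/-! ### D. The transport relation -/

section transport

variable {θ : EuclideanSpace ℝ (Fin 3) → ℝ} {e : EuclideanSpace ℝ (Fin 3)} {I : Set ℝ} {μ μ' K K' : ℝ → ℝ} {G : ℝ × ℝ → ℝ} {β : ℝ}

/-- Derivative of an `s`-free coefficient `q ↦ f(q₂)` along the sheet directions. -/
theorem fderiv_comp_snd {f : ℝ → ℝ} {f' z : ℝ} (s : ℝ) (hf : HasDerivAt f f' z) (h : ℝ × ℝ) :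
    fderiv ℝ (fun q : ℝ × ℝ => f q.2) (s, z) h = h.2 * f' := by
  have hf' : HasFDerivAt f (ContinuousLinearMap.smulRight (1 : ℝ →L[ℝ] ℝ) f') (((s, z) : ℝ × ℝ).2) := hf.hasFDerivAt
  have hc := hf'.comp ((s, z) : ℝ × ℝ) hasFDerivAt_snd
  rw [show (fun q : ℝ × ℝ => f q.2) = f ∘ Prod.snd from rfl, hc.fderiv]
  simp [mul_comm]

/-- ★ **THE EIKONAL AND TRANSPORT RELATIONS ON AN `s`-MODULATED SONIC WEB SHEET.**  See the module docstring. -/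
theorem eikonal_transport_on_sonic_sheet (hθ : ContDiff ℝ 3 θ) (he2 : e 2 = 0) (hI : IsOpen I) (hG : ContDiffOn ℝ 2 G (region I))
    (hμ : ∀ z ∈ I, HasDerivAt μ (μ' z) z) (hK : ∀ z ∈ I, HasDerivAt K (K' z) z)
    (hlaw : ∀ x : EuclideanSpace ℝ (Fin 3), x 2 ∈ I →
      fderiv ℝ (fderiv ℝ θ) x e2 e2 = -μ (x 2) * (fderiv ℝ (fderiv ℝ θ) x e e + fderiv ℝ (fderiv ℝ θ) x (Jvec e) (Jvec e)))
    (hce : ∀ p ∈ region I, fderiv ℝ θ (webMap e G p) e = 0)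
    (hcJ : ∀ p ∈ region I, fderiv ℝ θ (webMap e G p) (Jvec e) = 0)
    (hc2 : ∀ p ∈ region I, fderiv ℝ θ (webMap e G p) e2 = β)
    (hridge : ∀ p ∈ region I,
      fderiv ℝ (fderiv ℝ θ) (webMap e G p) e e + fderiv ℝ (fderiv ℝ θ) (webMap e G p) (Jvec e) (Jvec e) = -K p.2)
    (hA : ∀ p ∈ region I, fderiv ℝ (fderiv ℝ θ) (webMap e G p) (Jvec e) (Jvec e) ≠ 0) :
    ∀ p ∈ region I,
      fderiv ℝ G p (0, 1) ^ 2 = -μ p.2 * (1 + fderiv ℝ G p (1, 0) ^ 2) ∧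
      μ p.2 ^ 2 * K p.2 ^ 2 * fderiv ℝ (fun q => fderiv ℝ G q (1, 0)) p (1, 0) =
        -(1 + fderiv ℝ G p (1, 0) ^ 2) * fderiv ℝ G p (0, 1) * (1 / 2 * μ' p.2 * K p.2 ^ 2 + 2 * μ p.2 * K p.2 * K' p.2) := by
  rintro ⟨s, z⟩ hp
  have hz : z ∈ I := hp
  have hθ2 : ContDiff ℝ 2 θ := hθ.of_le (by norm_cast)
  have hH := hessian_on_sonic_sheet hθ he2 hI hG hlaw hce hcJ hc2 hA
  -- names
  set x := webMap e G (s, z) with hx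
  set T3 := fderiv ℝ (fderiv ℝ (fderiv ℝ θ)) x with hT3
  set A : ℝ := fderiv ℝ (fderiv ℝ θ) x (Jvec e) (Jvec e) with hAdef
  set Ps : ℝ := fderiv ℝ G (s, z) (1, 0) with hPs
  set Pz : ℝ := fderiv ℝ G (s, z) (0, 1) with hPz
  set Pss : ℝ := fderiv ℝ (fun q => fderiv ℝ G q (1, 0)) (s, z) (1, 0) with hPss
  set Psz : ℝ := fderiv ℝ (fun q => fderiv ℝ G q (1, 0)) (s, z) (0, 1) with hPsz
  set Pzs : ℝ := fderiv ℝ (fun q => fderiv ℝ G q (0, 1)) (s, z) (1, 0) with hPzs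
  set Pzz : ℝ := fderiv ℝ (fun q => fderiv ℝ G q (0, 1)) (s, z) (0, 1) with hPzz
  set As : ℝ := fderiv ℝ (fun q => fderiv ℝ (fderiv ℝ θ) (webMap e G q) (Jvec e) (Jvec e)) (s, z) (1, 0) with hAs
  set Az : ℝ := fderiv ℝ (fun q => fderiv ℝ (fderiv ℝ θ) (webMap e G q) (Jvec e) (Jvec e)) (s, z) (0, 1) with hAz
  -- differentiability at the point
  have hGat : ContDiffAt ℝ 2 G (s, z) := hG.contDiffAt ((isOpen_region hI).mem_nhds hp)
  have hGd : DifferentiableAt ℝ G (s, z) := hGat.differentiableAt (by norm_num)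
  have hG1 : DifferentiableAt ℝ (fderiv ℝ G) (s, z) := (hGat.fderiv_right (m := 1) (by norm_num)).differentiableAt (by norm_num)
  have hPsd : DifferentiableAt ℝ (fun q => fderiv ℝ G q (1, 0)) (s, z) := hG1.clm_apply (differentiableAt_const _)
  have hPzd : DifferentiableAt ℝ (fun q => fderiv ℝ G q (0, 1)) (s, z) := hG1.clm_apply (differentiableAt_const _)
  have hAd : DifferentiableAt ℝ (fun q => fderiv ℝ (fderiv ℝ θ) (webMap e G q) (Jvec e) (Jvec e)) (s, z) :=
    differentiableAt_hess_comp hθ hGd _ _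
  have hℋd : DifferentiableAt ℝ (fun q => fderiv ℝ (fderiv ℝ θ) (webMap e G q) e (Jvec e)) (s, z) :=
    differentiableAt_hess_comp hθ hGd _ _
  have h𝒞d : DifferentiableAt ℝ (fun q => fderiv ℝ (fderiv ℝ θ) (webMap e G q) e2 (Jvec e)) (s, z) :=
    differentiableAt_hess_comp hθ hGd _ _
  have hKd : DifferentiableAt ℝ (fun q : ℝ × ℝ => K q.2) (s, z) := (hK z hz).differentiableAt.comp _ differentiableAt_snd
  have hμd : DifferentiableAt ℝ (fun q : ℝ × ℝ => μ q.2) (s, z) := (hμ z hz).differentiableAt.comp _ differentiableAt_snd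
  -- symmetries
  have s12 : ∀ a b c, T3 a b c = T3 b a c := fun a b c => fderiv3_swap12 hθ x a b c
  have s23 : ∀ a b c, T3 a b c = T3 a c b := fun a b c => fderiv3_swap23 hθ x a b c
  have hsymG : Psz = Pzs := by
    rw [hPsz, hPzs, fderiv_clm_apply hG1 (differentiableAt_const _), fderiv_clm_apply hG1 (differentiableAt_const _)]
    simp only [fderiv_fun_const, Pi.zero_apply, ContinuousLinearMap.comp_zero, zero_add, ContinuousLinearMap.flip_apply]
    exact (hGat.isSymmSndFDerivAt (by simp)) (0, 1) (1, 0)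
  -- tangential derivatives of `A`
  have ha1 : As = T3 e (Jvec e) (Jvec e) + Ps * T3 (Jvec e) (Jvec e) (Jvec e) := by
    rw [hAs, fderiv_hess_comp hθ hGd]
    simp [hT3, hx, hPs, map_add, map_smul, _root_.add_apply, _root_.smul_apply]
  have ha2 : Az = Pz * T3 (Jvec e) (Jvec e) (Jvec e) + T3 e2 (Jvec e) (Jvec e) := by
    rw [hAz, fderiv_hess_comp hθ hGd]
    simp [hT3, hx, hPz, map_add, map_smul, _root_.add_apply, _root_.smul_apply]
  -- region identities from part C
  have hB : ∀ q ∈ region I, (fun q => fderiv ℝ (fderiv ℝ θ) (webMap e G q) e (Jvec e) +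
      fderiv ℝ G q (1, 0) * fderiv ℝ (fderiv ℝ θ) (webMap e G q) (Jvec e) (Jvec e)) q = 0 := fun q hq => by
    have h := (hH q hq).1; simp only; linear_combination h
  have hC : ∀ q ∈ region I, (fun q => fderiv ℝ (fderiv ℝ θ) (webMap e G q) e2 (Jvec e) +
      fderiv ℝ G q (0, 1) * fderiv ℝ (fderiv ℝ θ) (webMap e G q) (Jvec e) (Jvec e)) q = 0 := fun q hq => by
    have h := (hH q hq).2.1; simp only; linear_combination h
  have hR : ∀ q ∈ region I, (fun q => fderiv ℝ (fderiv ℝ θ) (webMap e G q) (Jvec e) (Jvec e) *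
      (1 + fderiv ℝ G q (1, 0) * fderiv ℝ G q (1, 0)) + K q.2) q = 0 := fun q hq => by
    have h3 := (hH q hq).2.2.1; have hr := hridge q hq; simp only; rw [h3] at hr; linear_combination hr
  have hEr : ∀ q ∈ region I, (fun q => fderiv ℝ G q (0, 1) * fderiv ℝ G q (0, 1) +
      μ q.2 * (1 + fderiv ℝ G q (1, 0) * fderiv ℝ G q (1, 0))) q = 0 := fun q hq => by
    have h := (hH q hq).2.2.2.2; simp only; linear_combination h
  -- (b1): `∂_s` of `hB`
  have hb1 : T3 e e (Jvec e) + Ps * T3 e (Jvec e) (Jvec e) + Pss * A + Ps * As = 0 := by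
    have h := fderiv_eq_zero_of_eqOn_region hI hB hp (1, 0)
    rw [fderiv_fun_add hℋd (hPsd.fun_mul hAd), fderiv_fun_mul hPsd hAd] at h
    simp only [_root_.add_apply, _root_.smul_apply, smul_eq_mul] at h
    rw [← hx, ← hAdef, ← hAs, ← hPss, ← hPs, fderiv_hess_comp hθ hGd e (Jvec e) (1, 0)] at h
    simp only [one_smul, zero_smul, add_zero, map_add, map_smul, _root_.add_apply, _root_.smul_apply, smul_eq_mul] at h
    rw [← hx, ← hT3, ← hPs, s12 (Jvec e) e (Jvec e)] at h
    linear_combination h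
  -- (b2): `∂_z` of `hC`
  have hb2 : Pz * T3 e2 (Jvec e) (Jvec e) + T3 e2 e2 (Jvec e) + Pzz * A + Pz * Az = 0 := by
    have h := fderiv_eq_zero_of_eqOn_region hI hC hp (0, 1)
    rw [fderiv_fun_add h𝒞d (hPzd.fun_mul hAd), fderiv_fun_mul hPzd hAd] at h
    simp only [_root_.add_apply, _root_.smul_apply, smul_eq_mul] at h
    rw [← hx, ← hAdef, ← hAz, ← hPzz, ← hPz, fderiv_hess_comp hθ hGd e2 (Jvec e) (0, 1)] at h
    simp only [one_smul, zero_smul, zero_add, map_add, map_smul, _root_.add_apply, _root_.smul_apply, smul_eq_mul] at h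
    rw [← hx, ← hT3, ← hPz, s12 (Jvec e) e2 (Jvec e)] at h
    linear_combination h
  -- (P1): `∂_{Je}` of the slice law at `x`, along the horizontal line `t ↦ x + t•Je` (on which `μ` is constant)
  have hP1 : T3 e2 e2 (Jvec e) + μ z * T3 e e (Jvec e) + μ z * T3 (Jvec e) (Jvec e) (Jvec e) = 0 := by
    have hx2 : ∀ t : ℝ, (x + t • Jvec e) 2 = z := fun t => by
      have := webMap_apply_two he2 G (s, z); rw [← hx] at this; simp [this, Jvec]
    have hℓ0 : ∀ t : ℝ, fderiv ℝ (fderiv ℝ θ) (x + t • Jvec e) e2 e2 +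
        μ z * (fderiv ℝ (fderiv ℝ θ) (x + t • Jvec e) e e + fderiv ℝ (fderiv ℝ θ) (x + t • Jvec e) (Jvec e) (Jvec e)) = 0 := by
      intro t
      have h := hlaw (x + t • Jvec e) (by rw [hx2]; exact hz)
      rw [hx2] at h
      linear_combination h
    have hℓ : HasDerivAt (fun t : ℝ => fderiv ℝ (fderiv ℝ θ) (x + t • Jvec e) e2 e2 +
        μ z * (fderiv ℝ (fderiv ℝ θ) (x + t • Jvec e) e e + fderiv ℝ (fderiv ℝ θ) (x + t • Jvec e) (Jvec e) (Jvec e)))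
        (T3 (Jvec e) e2 e2 + μ z * (T3 (Jvec e) e e + T3 (Jvec e) (Jvec e) (Jvec e))) 0 :=
      (hasDerivAt_hess_line hθ x (Jvec e) e2 e2).add
        (((hasDerivAt_hess_line hθ x (Jvec e) e e).add (hasDerivAt_hess_line hθ x (Jvec e) (Jvec e) (Jvec e))).const_mul (μ z))
    have hfun : (fun t : ℝ => fderiv ℝ (fderiv ℝ θ) (x + t • Jvec e) e2 e2 +
        μ z * (fderiv ℝ (fderiv ℝ θ) (x + t • Jvec e) e e + fderiv ℝ (fderiv ℝ θ) (x + t • Jvec e) (Jvec e) (Jvec e))) = fun _ => 0 :=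
      funext hℓ0
    rw [hfun] at hℓ
    have h0 := hℓ.unique (hasDerivAt_const (0 : ℝ) (0 : ℝ))
    rw [s12 (Jvec e) e2 e2, s23 e2 (Jvec e) e2, s12 (Jvec e) e e, s23 e (Jvec e) e] at h0
    linear_combination h0
  -- (E) at the point
  have hE : Pz ^ 2 + μ z * (1 + Ps ^ 2) = 0 := by
    have h := (hH (s, z) hp).2.2.2.2; linear_combination h
  -- ★ the graph transport law
  have hstar := star_algebra (t2 := T3 e (Jvec e) (Jvec e)) (t3 := T3 e2 (Jvec e) (Jvec e)) hP1 hb1 hb2 ha1 ha2 hE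
  -- (r1), (r2): tangential derivatives of the ridge law
  have hr1 : As * (1 + Ps ^ 2) + 2 * A * Ps * Pss = 0 := by
    have h := fderiv_eq_zero_of_eqOn_region hI hR hp (1, 0)
    rw [fderiv_fun_add (hAd.fun_mul ((hPsd.fun_mul hPsd).const_add 1)) hKd, fderiv_fun_mul hAd ((hPsd.fun_mul hPsd).const_add 1),
      fderiv_const_add, fderiv_fun_mul hPsd hPsd] at h
    simp only [_root_.add_apply, _root_.smul_apply, smul_eq_mul] at h
    rw [fderiv_comp_snd s (hK z hz), ← hx, ← hAdef, ← hAs, ← hPss, ← hPs] at h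
    simp only at h
    linear_combination h
  have hr2 : Az * (1 + Ps ^ 2) + 2 * A * Ps * Psz + K' z = 0 := by
    have h := fderiv_eq_zero_of_eqOn_region hI hR hp (0, 1)
    rw [fderiv_fun_add (hAd.fun_mul ((hPsd.fun_mul hPsd).const_add 1)) hKd, fderiv_fun_mul hAd ((hPsd.fun_mul hPsd).const_add 1),
      fderiv_const_add, fderiv_fun_mul hPsd hPsd] at h
    simp only [_root_.add_apply, _root_.smul_apply, smul_eq_mul] at h
    rw [fderiv_comp_snd s (hK z hz), ← hx, ← hAdef, ← hAz, ← hPsz, ← hPs] at h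
    simp only at h
    linear_combination h
  -- (e1), (e2): tangential derivatives of the eikonal relation
  have he1 : 2 * Pz * Pzs + 2 * μ z * Ps * Pss = 0 := by
    have h := fderiv_eq_zero_of_eqOn_region hI hEr hp (1, 0)
    rw [fderiv_fun_add (hPzd.fun_mul hPzd) (hμd.fun_mul ((hPsd.fun_mul hPsd).const_add 1)), fderiv_fun_mul hPzd hPzd,
      fderiv_fun_mul hμd ((hPsd.fun_mul hPsd).const_add 1), fderiv_const_add, fderiv_fun_mul hPsd hPsd] at h
    simp only [_root_.add_apply, _root_.smul_apply, smul_eq_mul] at h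
    rw [fderiv_comp_snd s (hμ z hz), ← hPss, ← hPzs, ← hPs, ← hPz] at h
    simp only at h
    linear_combination h
  have he2 : 2 * Pz * Pzz + μ' z * (1 + Ps ^ 2) + 2 * μ z * Ps * Psz = 0 := by
    have h := fderiv_eq_zero_of_eqOn_region hI hEr hp (0, 1)
    rw [fderiv_fun_add (hPzd.fun_mul hPzd) (hμd.fun_mul ((hPsd.fun_mul hPsd).const_add 1)), fderiv_fun_mul hPzd hPzd,
      fderiv_fun_mul hμd ((hPsd.fun_mul hPsd).const_add 1), fderiv_const_add, fderiv_fun_mul hPsd hPsd] at h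
    simp only [_root_.add_apply, _root_.smul_apply, smul_eq_mul] at h
    rw [fderiv_comp_snd s (hμ z hz), ← hPsz, ← hPzz, ← hPs, ← hPz] at h
    simp only at h
    linear_combination h
  have hRd : A * (1 + Ps ^ 2) + K z = 0 := by
    have h := hR (s, z) hp; simp only at h; rw [← hx, ← hAdef, ← hPs] at h; linear_combination h
  have hq : (1 + Ps ^ 2) ≠ 0 := by positivity
  refine ⟨by linear_combination hE, ?_⟩
  exact transport_algebra hq hstar hr1 hr2 he1 he2 (by rw [hsymG]; ring) hE hRd

end transport

/-! ### E. B-T: the webs at a sonic time are parallel lines -/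

section composite

variable {θ : EuclideanSpace ℝ (Fin 3) → ℝ} {e : EuclideanSpace ℝ (Fin 3)} {I : Set ℝ} {μ μ' K K' : ℝ → ℝ} {G : ℝ × ℝ → ℝ} {β r : ℝ}

/-- ★★ **B-T: ON AN `s`-MODULATED SONIC WEB SHEET THE WEBS ARE `e`-PARALLEL LINES AND `d′² = −μ`.**  Hypotheses of `eikonal_transport_on_sonic_sheet` plus
`μ < 0` on `I` and the tube bound `|G| ≤ r` ⇒ `G(s,z) = G(0,z)` on the region and `(d/dz G(0,z))² = −μ(z)`. -/
theorem sfree_of_sonic_sheet (hθ : ContDiff ℝ 3 θ) (he2 : e 2 = 0) (hI : IsOpen I) (hG : ContDiffOn ℝ 2 G (region I))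
    (hμ : ∀ z ∈ I, HasDerivAt μ (μ' z) z) (hK : ∀ z ∈ I, HasDerivAt K (K' z) z) (hμneg : ∀ z ∈ I, μ z < 0)
    (hlaw : ∀ x : EuclideanSpace ℝ (Fin 3), x 2 ∈ I →
      fderiv ℝ (fderiv ℝ θ) x e2 e2 = -μ (x 2) * (fderiv ℝ (fderiv ℝ θ) x e e + fderiv ℝ (fderiv ℝ θ) x (Jvec e) (Jvec e)))
    (hce : ∀ p ∈ region I, fderiv ℝ θ (webMap e G p) e = 0)
    (hcJ : ∀ p ∈ region I, fderiv ℝ θ (webMap e G p) (Jvec e) = 0)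
    (hc2 : ∀ p ∈ region I, fderiv ℝ θ (webMap e G p) e2 = β)
    (hridge : ∀ p ∈ region I,
      fderiv ℝ (fderiv ℝ θ) (webMap e G p) e e + fderiv ℝ (fderiv ℝ θ) (webMap e G p) (Jvec e) (Jvec e) = -K p.2)
    (hA : ∀ p ∈ region I, fderiv ℝ (fderiv ℝ θ) (webMap e G p) (Jvec e) (Jvec e) ≠ 0)
    (hGb : ∀ p ∈ region I, |G p| ≤ r) :
    (∀ p ∈ region I, G p = G (0, p.2)) ∧ ∀ z ∈ I, deriv (fun z => G (0, z)) z ^ 2 = -μ z := by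
  have hET := eikonal_transport_on_sonic_sheet hθ he2 hI hG hμ hK hlaw hce hcJ hc2 hridge hA
  have hH := hessian_on_sonic_sheet hθ he2 hI hG hlaw hce hcJ hc2 hA
  -- `K ≠ 0` on `I` (ridge law + rank-one Hessian + `A ≠ 0`)
  have hKne : ∀ z ∈ I, K z ≠ 0 := by
    intro z hz hK0
    have hp : ((0 : ℝ), z) ∈ region I := hz
    have h3 := (hH _ hp).2.2.1
    have hr := hridge _ hp
    rw [h3] at hr
    simp only at hr
    rw [hK0, neg_zero] at hr
    have : fderiv ℝ (fderiv ℝ θ) (webMap e G (0, z)) (Jvec e) (Jvec e) * (1 + fderiv ℝ G (0, z) (1, 0) ^ 2) = 0 := by linear_combination hr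
    rcases mul_eq_zero.1 this with h | h
    · exact hA _ hp h
    · nlinarith [sq_nonneg (fderiv ℝ G (0, z) (1, 0))]
  exact sfree_eikonal hI hG hGb (a := fun z => μ z ^ 2 * K z ^ 2) (b := fun z => 1 / 2 * μ' z * K z ^ 2 + 2 * μ z * K z * K' z) hμneg
    (fun z hz => mul_ne_zero (pow_ne_zero 2 (hμneg z hz).ne) (pow_ne_zero 2 (hKne z hz)))
    (fun p hp => (hET p hp).1) (fun p hp => (hET p hp).2)

end composite

end Summit.NavierStokesRegularity.NavierStokesRegularity.Theorems.PoloidalWindowDoorLrcModEntireGraphTransport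

end
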